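import Summits.AnomalousDissipation.AnomalousDissipation.Theses.TwoAndHalfD
import Literature.Barriers.AnomalousDissipation.ObukhovCorrsinThresholdProofs
import Literature.Analysis.FluidPDE.PassiveScalarClassicalWeak
import Literature.Analysis.FluidPDE.PassiveScalarClassicalEnergy
import Literature.Analysis.FluidPDE.ReleaseLogBoundSmooth
import Summits.AnomalousDissipation.AnomalousDissipation.Theorems.TwoAndHalfDTwohalfdThesisStubWeakDuhamel

/-!
# R1 `stub_ocGate` — the Obukhov–Corrsin gate of the line `Sketch` (crux stmt-AnomalousDissipation-0206)

Registered tool stub of the line `Sketch` (duhamel-release) for the crux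
`Summit.AnomalousDissipation.AnomalousDissipation.Theses.TwoAndHalfD.TwohalfdThesis`
(stmt-AnomalousDissipation-0206): a NECESSARY CONDITION on the line's released families, read off the
catalogued (and proved) Obukhov–Corrsin barrier `DrivasElgindiIyerJeong2022_thm4`
(`Literature/Barriers/AnomalousDissipation/ObukhovCorrsinThreshold(Proofs)`).

CONTENT (`stub_ocGate`, the registered planar statement). Classical releases `φ j s` of one smooth
pattern `h` (`‖h‖₂ > 0`) into drifts `v j` (diffusivity `ν j`, `ν j → 0`) from every time `s ≥ 0`, which
lose the fraction `δ > 0` of `‖h‖²` by age `τ₀ > 0` from every release time `s ≥ s₀`. Fix Hölder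
exponents `α, β ∈ (0,1]` above the Obukhov–Corrsin line, `α + 2β > 1`, and budgets `K, M` with
`‖h‖_{C^{0,β}} ≤ M`. Then for all large `j` and every `s ≥ s₀`: if the shifted drift `t ↦ v j (s+t)` lies
in `L¹(0,τ₀; C^{0,α})` with norm `≤ K`, the shifted release `t ↦ φ j s (s+t)` is NOT bounded by `M` in
`C^{0,β}` for a.e. `t ∈ (0,τ₀)`.

PROOF. `DrivasElgindiIyerJeong2022_thm4_holds (Fin 2) τ₀ … α β … K M 1` gives `C` with
`eScalarDissipation κ θ 0 τ₀ ≤ ofReal (C κ^p)`, `p = (α+2β-1)/(α+1) > 0`, for every admissible (drift,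
datum, weak solution with the energy inequality, `C^β` bound) with `κ ≤ 1`. The shifted release
`θ t = φ j s (s+t)` is classical on `[0, ∞)` (`isClassicalScalarTransportOn_comp_add_const`), hence a weak
solution on `[0, τ₀)` with datum `θ 0 = h` (`IsClassicalScalarTransportOn.isWeakScalarTransportOn_holds`),
and it satisfies the energy EQUALITY `‖θ(t)‖² + 2κ∫₀ᵗ‖∇θ‖² = ‖h‖²`
(`scalarL2Sq_add_scalarDissipation_holds`; `eScalarDissipation_eq_ofReal` and
`lintegral_enorm_sq_eq_ofReal_integral_sq` pass to `ℝ≥0∞`), so the barrier applies; the loss gives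
`2κ∫₀^{τ₀}‖∇θ‖² ≥ δ‖h‖²`, while `C (ν j)^p → 0` and `ν j ≤ 1` eventually — contradiction for large `j`.
Supports stmt-AnomalousDissipation-0206. [cite: DrivasEtAl2022, Thm. 4]
-/

noncomputable section

-- the summit path `AnomalousDissipation/AnomalousDissipation` duplicates a namespace component
set_option linter.dupNamespace false

namespace Summit.AnomalousDissipation.AnomalousDissipation.Theorems.TwohalfdThesis

open MeasureTheory Set Filter Topology
open scoped ENNReal NNReal
open Literature.Analysis.FunctionSpaces Literature.Analysis.FluidPDE

section General

variable {d : Type*} [Fintype d] [DecidableEq d]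

/-- **The energy balance of a classical release in `ℝ≥0∞` currency.** For a classical solution `θ` of
`∂ₜθ + u·∇θ = κΔθ` (`κ ≥ 0`) on `[0, ∞) × T^d` and every `t > 0`:
`∫⁻‖θ t‖ₑ² + 2·eScalarDissipation κ θ 0 t = ∫⁻‖θ 0‖ₑ²` — the energy equality
`‖θ(t)‖² + 2κ∫₀ᵗ‖∇θ‖² = ‖θ(0)‖²` (`scalarL2Sq_add_scalarDissipation_holds`) transported through
`eScalarDissipation_eq_ofReal` and `lintegral_enorm_sq_eq_ofReal_integral_sq`; in particular the energy
INEQUALITY clause of `DrivasElgindiIyerJeong2022_thm4` holds at every time. [cite: DrivasEtAl2022, (1.2)–(1.3)] -/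
theorem ocGate_lintegral_sq_add_two_mul_eScalarDissipation_eq {κ : ℝ} (hκ : 0 ≤ κ)
    {u : ℝ → UnitAddTorus d → EuclideanSpace ℝ d} {θ : ℝ → UnitAddTorus d → ℝ}
    (hθ : Torus.IsClassicalScalarTransportOn (Ici 0) κ u θ) {t : ℝ} (ht : 0 < t) :
    (∫⁻ x, ‖θ t x‖ₑ ^ 2) + 2 * Torus.eScalarDissipation κ θ 0 t = ∫⁻ x, ‖θ 0 x‖ₑ ^ 2 := by
  have hE := Torus.IsClassicalScalarTransportOn.scalarL2Sq_add_scalarDissipation_holds hθ ht.le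
    Icc_subset_Ici_self
  have hct : Continuous (θ t) := (hθ.smooth_scalar.isSmooth_slice (mem_Ici.2 ht.le)).continuous
  have hc0 : Continuous (θ 0) := (hθ.smooth_scalar.isSmooth_slice (mem_Ici.2 le_rfl)).continuous
  have hD : 0 ≤ 2 * Torus.scalarDissipation κ θ 0 t :=
    mul_nonneg zero_le_two (Torus.scalarDissipation_nonneg hκ θ ht.le)
  have key : ENNReal.ofReal (Torus.scalarL2Sq (θ t)) + ENNReal.ofReal (2 * Torus.scalarDissipation κ θ 0 t) =
      ENNReal.ofReal (Torus.scalarL2Sq (θ 0)) := by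
    rw [← ENNReal.ofReal_add (Torus.scalarL2Sq_nonneg _) hD, hE]
  rw [Torus.eScalarDissipation_eq_ofReal hκ ht (hθ.restrict_Icc ht Icc_subset_Ici_self),
    Torus.lintegral_enorm_sq_eq_ofReal_integral_sq hct, Torus.lintegral_enorm_sq_eq_ofReal_integral_sq hc0,
    ← ENNReal.ofReal_ofNat 2, ← ENNReal.ofReal_mul (by norm_num : (0 : ℝ) ≤ 2)]
  exact key

/-- **The Obukhov–Corrsin gate for one classical release (every dimension).** Let `C` be a constant of
the barrier `DrivasElgindiIyerJeong2022_thm4` on the window `[0, τ₀]` for the exponents `α, β` and the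
budgets `K, M, κ₀ = 1`, and let `θ` be a classical solution of `∂ₜθ + u·∇θ = κΔθ` on `[0, ∞) × T^d`,
`0 < κ ≤ 1`, with `‖θ 0‖_{C^{0,β}} ≤ M`, drift `u ∈ L¹(0,τ₀; C^{0,α})` of norm `≤ K`, and
`‖θ(t)‖_{C^{0,β}} ≤ M` for a.e. `t ∈ (0, τ₀)`. Then the variance lost on the window obeys
`‖θ 0‖² − ‖θ τ₀‖² ≤ 2 C κ^{(α+2β-1)/(α+1)}`: the classical solution is an admissible weak solution
(`isWeakScalarTransportOn_holds`, energy equality), the barrier bounds `κ∫₀^{τ₀}‖∇θ‖²`, and the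
energy equality converts dissipation into loss. [cite: DrivasEtAl2022, Thm. 4] -/
theorem ocGate_loss_le {τ₀ : ℝ} (hτ₀ : 0 < τ₀) {α β K M : ℝ≥0} {C : ℝ≥0}
    (hC : ∀ (u : ℝ → UnitAddTorus d → EuclideanSpace ℝ d) (_hu : MemLpHolder 1 α u (Ioo 0 τ₀))
        (_huK : eLpHolderNorm 1 α u (Ioo 0 τ₀) ≤ K)
        (θ₀ : UnitAddTorus d → ℝ) (_hθ₀ : eBoundedHolderNorm β θ₀ ≤ M)
        (κ : ℝ) (_hκ : 0 < κ) (_hκ₀ : κ ≤ (1 : ℝ≥0))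
        (θ : ℝ → UnitAddTorus d → ℝ) (_hθ : Torus.IsWeakScalarTransportOn τ₀ κ u θ₀ θ)
        (_henergy : ∀ᵐ t ∂(volume.restrict (Ioo 0 τ₀)),
          (∫⁻ x, ‖θ t x‖ₑ ^ 2) + 2 * Torus.eScalarDissipation κ θ 0 t ≤ ∫⁻ x, ‖θ₀ x‖ₑ ^ 2)
        (_hbound : ∀ᵐ t ∂(volume.restrict (Ioo 0 τ₀)), eBoundedHolderNorm β (θ t) ≤ M),
        Torus.eScalarDissipation κ θ 0 τ₀ ≤
          ENNReal.ofReal (C * κ ^ (((α : ℝ) + 2 * β - 1) / (α + 1))))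
    {κ : ℝ} (hκ : 0 < κ) (hκ1 : κ ≤ 1)
    {u : ℝ → UnitAddTorus d → EuclideanSpace ℝ d} {θ : ℝ → UnitAddTorus d → ℝ}
    (hθ : Torus.IsClassicalScalarTransportOn (Ici 0) κ u θ)
    (hu : MemLpHolder 1 α u (Ioo 0 τ₀)) (huK : eLpHolderNorm 1 α u (Ioo 0 τ₀) ≤ K)
    (hθ₀ : eBoundedHolderNorm β (θ 0) ≤ M)
    (hbound : ∀ᵐ t ∂(volume.restrict (Ioo 0 τ₀)), eBoundedHolderNorm β (θ t) ≤ M) :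
    Torus.scalarL2Sq (θ 0) - Torus.scalarL2Sq (θ τ₀) ≤
      2 * (C * κ ^ (((α : ℝ) + 2 * β - 1) / (α + 1))) := by
  -- the classical solution is a weak solution with datum `θ 0` obeying the energy equality
  have hweak : Torus.IsWeakScalarTransportOn τ₀ κ u (θ 0) θ :=
    Torus.IsClassicalScalarTransportOn.isWeakScalarTransportOn_holds hθ Icc_subset_Ici_self
  have henergy : ∀ᵐ t ∂(volume.restrict (Ioo 0 τ₀)),
      (∫⁻ x, ‖θ t x‖ₑ ^ 2) + 2 * Torus.eScalarDissipation κ θ 0 t ≤ ∫⁻ x, ‖θ 0 x‖ₑ ^ 2 :=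
    (ae_restrict_mem measurableSet_Ioo).mono fun t ht =>
      (ocGate_lintegral_sq_add_two_mul_eScalarDissipation_eq hκ.le hθ ht.1).le
  -- the barrier
  have hdis := hC u hu huK (θ 0) hθ₀ κ hκ (by exact_mod_cast hκ1) θ hweak henergy hbound
  rw [Torus.eScalarDissipation_eq_ofReal hκ.le hτ₀ (hθ.restrict_Icc hτ₀ Icc_subset_Ici_self)] at hdis
  have hRHS : 0 ≤ (C : ℝ) * κ ^ (((α : ℝ) + 2 * β - 1) / (α + 1)) := by positivity
  have hsd : Torus.scalarDissipation κ θ 0 τ₀ ≤ C * κ ^ (((α : ℝ) + 2 * β - 1) / (α + 1)) :=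
    (ENNReal.ofReal_le_ofReal_iff hRHS).1 hdis
  -- the energy equality on the whole window
  have hE := Torus.IsClassicalScalarTransportOn.scalarL2Sq_add_scalarDissipation_holds hθ hτ₀.le
    Icc_subset_Ici_self
  linarith

end General

/-- **R1 `stub_ocGate` (line `Sketch` = duhamel-release, crux `TwoAndHalfD.TwohalfdThesis`; registered
signature) — the Obukhov–Corrsin gate for released families.** Classical releases `φ j s` of one smooth
`h` (`‖h‖₂ > 0`) into the drifts `v j` from every `s ≥ 0`, losing the fraction `δ > 0` of `‖h‖²` by age
`τ₀ > 0` from every release time `s ≥ s₀`, `ν_j → 0`. For Hölder exponents `α, β ∈ (0,1]` with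
`α + 2β > 1` and budgets `K, M` (`‖h‖_{C^{0,β}} ≤ M`): for all large `j` and every `s ≥ s₀`, if the
shifted drift `t ↦ v j (s+t)` lies in `L¹(0,τ₀; C^{0,α})` with norm `≤ K`, then the shifted release
`t ↦ φ j s (s+t)` is NOT bounded by `M` in `C^{0,β}` for a.e. `t ∈ (0,τ₀)` (the proved barrier
`DrivasElgindiIyerJeong2022_thm4_holds` with `κ₀ = 1`, the time shift
`isClassicalScalarTransportOn_comp_add_const`, `ocGate_loss_le`, and `C (ν j)^p → 0` for
`p = (α+2β-1)/(α+1) > 0`). [cite: DrivasEtAl2022, Thm. 4] -/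
theorem stub_ocGate :
    ∀ (ν : ℕ → ℝ) (v : ℕ → ℝ → (UnitAddTorus (Fin 2)) → (EuclideanSpace ℝ (Fin 2))) (h : (UnitAddTorus (Fin 2)) → ℝ)
      (φ : ℕ → ℝ → ℝ → (UnitAddTorus (Fin 2)) → ℝ) (s₀ τ₀ δ : ℝ) (α β K M : ℝ≥0),
      (∀ j, 0 < ν j) → Tendsto ν atTop (𝓝 0) → Torus.IsSmooth h → 0 < Torus.scalarL2Sq h → 0 < τ₀ → 0 < δ →
      (∀ j s, 0 ≤ s → Torus.IsClassicalScalarTransportOn (Ici s) (ν j) (v j) (φ j s) ∧ φ j s s = h) →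
      0 ≤ s₀ →
      (∀ j s, s₀ ≤ s → Torus.scalarL2Sq (φ j s (s + τ₀)) ≤ (1 - δ) * Torus.scalarL2Sq h) →
      0 < α → α ≤ 1 → 0 < β → β ≤ 1 → 1 < (α : ℝ) + 2 * β →
      eBoundedHolderNorm β h ≤ M →
      ∀ᶠ j in atTop, ∀ s, s₀ ≤ s →
        MemLpHolder 1 α (fun t => v j (s + t)) (Ioo 0 τ₀) →
        eLpHolderNorm 1 α (fun t => v j (s + t)) (Ioo 0 τ₀) ≤ K →
        ¬ (∀ᵐ t ∂(volume.restrict (Ioo 0 τ₀)), eBoundedHolderNorm β (φ j s (s + t)) ≤ M) := by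
  intro ν v h φ s₀ τ₀ δ α β K M hν hν0 _hh hhpos hτ₀ hδ hφ hs₀ hloss hα hα1 hβ hβ1 hOC hhM
  obtain ⟨C, hC⟩ := Literature.Barriers.AnomalousDissipation.DrivasElgindiIyerJeong2022_thm4_holds (Fin 2)
    τ₀ hτ₀ α β ⟨hα, hα1⟩ ⟨hβ, hβ1⟩ K M 1
  -- the barrier's bound `C (ν j)^p` tends to `0`
  have hexp : 0 < ((α : ℝ) + 2 * β - 1) / (α + 1) := by
    have : (0 : ℝ) < α + 1 := by positivity
    exact div_pos (by linarith) this
  have hpow : Tendsto (fun j => (C : ℝ) * ν j ^ (((α : ℝ) + 2 * β - 1) / (α + 1))) atTop (𝓝 0) := by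
    simpa using (hν0.rpow_const_nhds_zero hexp).const_mul (C : ℝ)
  have hgap : 0 < δ * Torus.scalarL2Sq h / 2 := by positivity
  have hev₁ : ∀ᶠ j in atTop, ν j ≤ 1 :=
    (hν0.eventually (Iic_mem_nhds one_pos)).mono fun j hj => hj
  have hev₂ : ∀ᶠ j in atTop, (C : ℝ) * ν j ^ (((α : ℝ) + 2 * β - 1) / (α + 1)) < δ * Torus.scalarL2Sq h / 2 :=
    (hpow.eventually (Iio_mem_nhds hgap)).mono fun j hj => hj
  filter_upwards [hev₁, hev₂] with j hj₁ hj₂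
  intro s hs hmem hK hbound
  have hs0 : 0 ≤ s := hs₀.trans hs
  obtain ⟨hcl, hφss⟩ := hφ j s hs0
  -- the shifted release `t ↦ φ j s (s + t)` is classical on `[0, ∞)` with datum `h`
  have hshift : Torus.IsClassicalScalarTransportOn (Ici 0) (ν j) (fun t => v j (s + t))
      (fun t => φ j s (s + t)) := by
    have h2 := isClassicalScalarTransportOn_comp_add_const hcl s
    rw [Set.preimage_add_const_Ici, sub_self] at h2
    have hu : (fun t => v j (s + t)) = fun σ => v j (σ + s) := funext fun σ => by rw [add_comm]
    have hθ : (fun t => φ j s (s + t)) = fun σ => φ j s (σ + s) := funext fun σ => by rw [add_comm]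
    rw [hu, hθ]
    exact h2
  have hhM' : eBoundedHolderNorm β (φ j s (s + 0)) ≤ M := by rw [add_zero, hφss]; exact hhM
  -- the gate for this release: `‖h‖² − ‖φ j s (s+τ₀)‖² ≤ 2 C (ν j)^p`
  have hmain : Torus.scalarL2Sq (φ j s (s + 0)) - Torus.scalarL2Sq (φ j s (s + τ₀)) ≤
      2 * ((C : ℝ) * ν j ^ (((α : ℝ) + 2 * β - 1) / (α + 1))) :=
    ocGate_loss_le hτ₀ hC (hν j) hj₁ hshift hmem hK hhM' hbound
  rw [add_zero, hφss] at hmain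
  -- … while the loss is `≥ δ‖h‖² > 2 C (ν j)^p`
  have hl := hloss j s hs
  linarith

end Summit.AnomalousDissipation.AnomalousDissipation.Theorems.TwohalfdThesis

end
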